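import Summits.Ventures.PercRepro.C041RelaxedTriangleBridge

/-!
# THE RELAXED TRIANGLE — the generator cone of the relaxed domain and (P) at the triangle on it
(mine-3, gen 59; C-041.md §21 (g)–(l))

THEOREM (RELAXED TRIANGLE) says: if two hanging one-anchor zones satisfy (P) — `K4v` — together with the TRIVIAL
BOUNDS `0 ≤ I_F`, `0 ≤ I₁ ≤ T₁`, `0 ≤ I₂ ≤ T₂` (`Rel`), then the triangle `a – u – u′ – a` carrying them satisfies (P):
`K4v (thetaTri w w′)`.  The proof is a convexity reduction: the relaxed domain is the convex CONE generated by the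
apex `1`, the recession rays `eT1`, `eT2` and the four extreme curves `sixF1`, `sixF2`, `sixF2m`, `sixF3` of
`C041RelaxedTriangleBridge` (`Base`; their non-negative combinations form `GenCone`); `thetaTri` is bilinear
(`thetaTri_add_left`, `thetaTri_smul_left`, `thetaTri_comm`) and `K4v` is a convex cone (`K4v_add`, `K4v_smul`), so
(P) at the output on `GenCone × GenCone` follows from the finitely many generator pairs (`K4v_thetaTri_base`):
curve × curve are the ten kernel cases of the bridge module (`thetaTri_comm` for the mirrored pairs), `w × 1` is (P)
of `w` itself (`K4v_thetaTri_one`: `thetaTri w 1 = 3ℓ(ψw) + 2w`), and `w × eT1` / `w × eT2` are the RAY CONDITION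
in homogeneous form (`ray_condition_hom`, `K4v_thetaTri_eT1_right`, `K4v_thetaTri_eT2_right`).  The decomposition
`Rel w → GenCone w` and the theorem itself are in `C041RelaxedTriangleMain`.
-/

namespace PercRepro

namespace RelaxedTriangle

open TreeClosure

/-! ## The relaxed domain, its generators and the cone they generate -/

/-- THE RELAXED DOMAIN: (P) together with the trivial bounds `0 ≤ I_F`, `0 ≤ I₁ ≤ T₁`, `0 ≤ I₂ ≤ T₂` of a
six-vector `(F, F + T₁, F + T₂, I_F, I_F + I₁, I_F + I₂)`. -/
structure Rel (w : Vec6) : Prop where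
  k4 : K4v w
  iF_nonneg : 0 ≤ w 3
  i1_nonneg : 0 ≤ w 4 - w 3
  i1_le : w 4 - w 3 ≤ w 1 - w 0
  i2_nonneg : 0 ≤ w 5 - w 3
  i2_le : w 5 - w 3 ≤ w 2 - w 0

/-- The recession ray `e_{T₁} = (0, 1, 0, 0, 0, 0)`: one valid type-1 state. -/
def eT1 : Vec6 := ![0, 1, 0, 0, 0, 0]

/-- The recession ray `e_{T₂} = (0, 0, 1, 0, 0, 0)`: one valid type-2 state. -/
def eT2 : Vec6 := ![0, 0, 1, 0, 0, 0]

/-- The generators of the relaxed domain: the apex `1` (one invalid state without type), the two rays and the four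
extreme curves (C-041.md §21 (h)). -/
inductive Base : Vec6 → Prop
  | one : Base 1
  | rayT1 : Base eT1
  | rayT2 : Base eT2
  | f1 (p : ℝ) (hp : 0 ≤ p) : Base (sixF1 p)
  | f2 (p : ℝ) (hp : 0 ≤ p) : Base (sixF2 p)
  | f2m (p : ℝ) (hp : 0 ≤ p) : Base (sixF2m p)
  | f3 (p : ℝ) (hp : 0 ≤ p) : Base (sixF3 p)

/-- The convex cone generated by `Base`. -/
inductive GenCone : Vec6 → Prop
  | base {w : Vec6} : Base w → GenCone w
  | add {x y : Vec6} : GenCone x → GenCone y → GenCone (x + y)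
  | smul {x : Vec6} (c : ℝ) (hc : 0 ≤ c) : GenCone x → GenCone (c • x)

/-! ## (P) is a convex cone condition; the triangle map is bilinear -/

/-- `K4v` is closed under addition. -/
theorem K4v_add {x y : Vec6} (hx : K4v x) (hy : K4v y) : K4v (x + y) := by
  unfold K4v at *
  have := hx.add hy
  convert this using 1 <;> simp only [Pi.add_apply] <;> ring

/-- `K4v` is closed under non-negative scaling. -/
theorem K4v_smul {x : Vec6} (hx : K4v x) {c : ℝ} (hc : 0 ≤ c) : K4v (c • x) := by
  unfold K4v at *
  have := hx.smul hc
  convert this using 1 <;> simp only [Pi.smul_apply, smul_eq_mul] <;> ring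

/-- **The triangle map, coordinate by coordinate** (`n = L₁ + L₂ − L₀`, `k = M₁ + M₂ − M₀` of each zone,
`N`, `K` the same for the product zone): an explicit bilinear form in the two six-vectors. -/
theorem thetaTri_eq_vec (w w' : Vec6) : thetaTri w w' =
    ![2 * (w 0 * w' 0) + (w 1 + w 2 - w 0) * (w' 1 + w' 2 - w' 0) + (w 1 + w 2) * w' 0 + w 0 * (w' 1 + w' 2)
        + (w 1 * w' 1 + w 2 * w' 2 - w 0 * w' 0),
      2 * (w 1 * w' 1) + (w 1 + w 2 - w 0) * (w' 1 + w' 2 - w' 0) + (2 * w 1 + w 2 - w 0) * w' 1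
        + w 1 * (2 * w' 1 + w' 2 - w' 0) + (w 1 * w' 1 + w 2 * w' 2 - w 0 * w' 0),
      2 * (w 2 * w' 2) + (w 1 + w 2 - w 0) * (w' 1 + w' 2 - w' 0) + (w 1 + 2 * w 2 - w 0) * w' 2
        + w 2 * (w' 1 + 2 * w' 2 - w' 0) + (w 1 * w' 1 + w 2 * w' 2 - w 0 * w' 0),
      2 * (w 0 * w' 0) + (w 4 + w 5 - w 3) * (w' 4 + w' 5 - w' 3) + (w 0 + (w 4 + w 5 - w 3)) * w' 3
        + w 3 * (w' 0 + (w' 4 + w' 5 - w' 3)) + (w 4 * w' 4 + w 5 * w' 5 - w 3 * w' 3),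
      2 * (w 1 * w' 1) + (w 4 + w 5 - w 3) * (w' 4 + w' 5 - w' 3) + (w 1 + (w 4 + w 5 - w 3)) * w' 4
        + w 4 * (w' 1 + (w' 4 + w' 5 - w' 3)) + (w 4 * w' 4 + w 5 * w' 5 - w 3 * w' 3),
      2 * (w 2 * w' 2) + (w 4 + w 5 - w 3) * (w' 4 + w' 5 - w' 3) + (w 2 + (w 4 + w 5 - w 3)) * w' 5
        + w 5 * (w' 2 + (w' 4 + w' 5 - w' 3)) + (w 4 * w' 4 + w 5 * w' 5 - w 3 * w' 3)] := by
  ext i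
  simp only [thetaTri_eq_sum, Pi.add_apply, Pi.mul_apply, thB, thR, ellv, ell, nAdm, kInv]
  fin_cases i <;> simp <;> ring

/-- The triangle map is additive in its first argument. -/
theorem thetaTri_add_left (x y w' : Vec6) : thetaTri (x + y) w' = thetaTri x w' + thetaTri y w' := by
  ext i
  simp only [thetaTri_eq_vec, Pi.add_apply]
  fin_cases i <;> simp <;> ring

/-- The triangle map is homogeneous in its first argument. -/
theorem thetaTri_smul_left (c : ℝ) (x w' : Vec6) : thetaTri (c • x) w' = c • thetaTri x w' := by
  ext i
  simp only [thetaTri_eq_vec, Pi.smul_apply, smul_eq_mul]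
  fin_cases i <;> simp <;> ring

/-- The triangle map is symmetric in its two zones. -/
theorem thetaTri_comm (w w' : Vec6) : thetaTri w w' = thetaTri w' w := by
  ext i
  simp only [thetaTri_eq_vec]
  fin_cases i <;> simp <;> ring

/-- The triangle map is additive in its second argument. -/
theorem thetaTri_add_right (w x y : Vec6) : thetaTri w (x + y) = thetaTri w x + thetaTri w y := by
  rw [thetaTri_comm, thetaTri_add_left, thetaTri_comm x, thetaTri_comm y]

/-- The triangle map is homogeneous in its second argument. -/
theorem thetaTri_smul_right (c : ℝ) (w x : Vec6) : thetaTri w (c • x) = c • thetaTri w x := by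
  rw [thetaTri_comm, thetaTri_smul_left, thetaTri_comm x]

/-! ## The apex and the rays against an arbitrary relaxed zone -/

/-- The triangle with the apex `1` at one exit: `θ_△(w, 1) = 3ℓ(ψw) + 2w`, whose 4-vector
`(8g + 3t₁ + 3t₂, 5t₁, 5t₂, 3g + 3t₁ + 3t₂ + 5k)` satisfies (P) exactly when `w` does. -/
theorem K4v_thetaTri_one {w : Vec6} (hw : K4v w) : K4v (thetaTri w 1) := by
  unfold K4v at *
  obtain ⟨h1, h2, h3, h4, h5⟩ := hw
  simp [thetaTri_eq_vec]
  refine ⟨?_, ?_, ?_, ?_, ?_⟩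
  · nlinarith
  · nlinarith
  · nlinarith
  · nlinarith
  · nlinarith [h5]

/-- THE RAY CONDITION, homogeneous form (C-041.md §21 (g), (k)): for a relaxed zone `(F, U₁, U₂, t, j₁, j₂)`
(`t = σ`, `j₂ = I₂`), `(t + j₂ + U₂)² ≤ U₂ (5F + 6U₁ + U₂)` — the Cauchy–Schwarz field of the triangle with the
ray `e_{T₁}` at the other exit. -/
theorem ray_condition_hom (F U1 U2 t j2 : ℝ) (hF : 0 ≤ F) (hU1 : 0 ≤ U1) (hU2 : 0 ≤ U2) (ht0 : 0 ≤ t)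
    (ht : t ^ 2 ≤ U1 * U2) (hj0 : 0 ≤ j2) (hjU : j2 ≤ U2) (hj : t + j2 ≤ F) :
    (t + j2 + U2) ^ 2 ≤ U2 * (5 * F + 6 * U1 + U2) := by
  have h2t : 2 * t ≤ U1 + U2 := by nlinarith [sq_nonneg (U1 - U2)]
  have hx0 : 0 ≤ t + j2 := by linarith
  rcases le_or_gt (t + U2) F with hm | hm
  · have hx : t + j2 ≤ t + U2 := by linarith
    have hU2le : U2 ≤ F := by linarith
    nlinarith [mul_nonneg hx0 (sub_nonneg.2 hx), mul_nonneg hj0 (sub_nonneg.2 hjU),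
      mul_nonneg hU2 (sub_nonneg.2 hm), mul_nonneg ht0 (sub_nonneg.2 hjU), mul_nonneg hU2 (sub_nonneg.2 h2t),
      mul_nonneg hU2 (sub_nonneg.2 hU2le), mul_nonneg hU1 hU2, mul_nonneg hF hU2]
  · have key : F ^ 2 ≤ 3 * F * U2 + 6 * U1 * U2 := by
      rcases le_or_gt F (3 * U2) with h3 | h3
      · nlinarith [mul_nonneg hU1 hU2, mul_nonneg hF (sub_nonneg.2 h3)]
      · have htF : 2 * F ≤ 3 * t := by linarith
        nlinarith [mul_nonneg hU1 hU2, mul_nonneg (sub_nonneg.2 htF) (by positivity : (0 : ℝ) ≤ 3 * t + 2 * F),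
          sq_nonneg F, mul_nonneg hF hU2]
    nlinarith [mul_nonneg hx0 (sub_nonneg.2 hj), mul_nonneg hU2 (sub_nonneg.2 hj), mul_nonneg hF (sub_nonneg.2 hj),
      key, mul_nonneg hU2 hU2, mul_nonneg hU1 hU2, mul_nonneg hF hU2]

/-- The triangle with the ray `e_{T₁}` at one exit and a relaxed zone at the other satisfies (P):
its 4-vector is `(2w₁ + w₂, 6w₁ + w₂ − 2w₀, w₂ − w₀, 2w₁ + w₄)`, `g − k = σ + I₂ + T₂`. -/
theorem K4v_thetaTri_eT1_right {w : Vec6} (hw : Rel w) : K4v (thetaTri w eT1) := by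
  obtain ⟨hk, h3, h4, h5, h6, h7⟩ := hw
  unfold K4v at hk ⊢
  obtain ⟨k1, k2, k3, k4, k5⟩ := hk
  have hr := ray_condition_hom (w 0) (w 1 - w 0) (w 2 - w 0) (w 0 - (w 4 + w 5 - w 3)) (w 5 - w 3)
    (by linarith) k1 k2 (by linarith) k5 h6 h7 (by linarith)
  simp [thetaTri_eq_vec, eT1]
  refine ⟨?_, ?_, ?_, ?_, ?_⟩
  · nlinarith
  · nlinarith
  · nlinarith
  · nlinarith
  · nlinarith [hr]

/-- The triangle with the ray `e_{T₂}` at one exit and a relaxed zone at the other satisfies (P) (the mirror). -/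
theorem K4v_thetaTri_eT2_right {w : Vec6} (hw : Rel w) : K4v (thetaTri w eT2) := by
  obtain ⟨hk, h3, h4, h5, h6, h7⟩ := hw
  unfold K4v at hk ⊢
  obtain ⟨k1, k2, k3, k4, k5⟩ := hk
  have hr := ray_condition_hom (w 0) (w 2 - w 0) (w 1 - w 0) (w 0 - (w 4 + w 5 - w 3)) (w 4 - w 3)
    (by linarith) k2 k1 (by linarith) (by rw [mul_comm]; exact k5) h4 h5 (by linarith)
  simp [thetaTri_eq_vec, eT2]
  refine ⟨?_, ?_, ?_, ?_, ?_⟩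
  · nlinarith
  · nlinarith
  · nlinarith
  · nlinarith
  · nlinarith [hr]

/-! ## The generators lie in the relaxed domain -/

/-- The apex `1` is relaxed-feasible. -/
theorem Rel_one : Rel (1 : Vec6) := by
  refine ⟨?_, ?_, ?_, ?_, ?_, ?_⟩
  · unfold K4v
    simp
    refine ⟨?_, ?_, ?_, ?_, ?_⟩ <;> norm_num
  all_goals simp

/-- The ray `e_{T₁}` is relaxed-feasible. -/
theorem Rel_eT1 : Rel eT1 := by
  refine ⟨?_, ?_, ?_, ?_, ?_, ?_⟩
  · unfold K4v
    simp [eT1]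
    refine ⟨?_, ?_, ?_, ?_, ?_⟩ <;> norm_num
  all_goals simp [eT1]

/-- The ray `e_{T₂}` is relaxed-feasible. -/
theorem Rel_eT2 : Rel eT2 := by
  refine ⟨?_, ?_, ?_, ?_, ?_, ?_⟩
  · unfold K4v
    simp [eT2]
    refine ⟨?_, ?_, ?_, ?_, ?_⟩ <;> norm_num
  all_goals simp [eT2]

/-- The F1 points are relaxed-feasible. -/
theorem Rel_sixF1 (p : ℝ) (hp : 0 ≤ p) : Rel (sixF1 p) := by
  refine ⟨?_, ?_, ?_, ?_, ?_, ?_⟩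
  · unfold K4v
    simp [sixF1, sixN]
    refine ⟨?_, ?_, ?_, ?_, ?_⟩ <;> nlinarith [sq_nonneg p]
  all_goals simp [sixF1, sixN] <;> nlinarith [sq_nonneg p]

/-- The F2 points are relaxed-feasible. -/
theorem Rel_sixF2 (p : ℝ) (hp : 0 ≤ p) : Rel (sixF2 p) := by
  refine ⟨?_, ?_, ?_, ?_, ?_, ?_⟩
  · unfold K4v
    simp [sixF2, sixN]
    refine ⟨?_, ?_, ?_, ?_, ?_⟩ <;> nlinarith [sq_nonneg p]
  all_goals simp [sixF2, sixN] <;> nlinarith [sq_nonneg p]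

/-- The F2′ points are relaxed-feasible. -/
theorem Rel_sixF2m (p : ℝ) (hp : 0 ≤ p) : Rel (sixF2m p) := by
  refine ⟨?_, ?_, ?_, ?_, ?_, ?_⟩
  · unfold K4v
    simp [sixF2m, sixN]
    refine ⟨?_, ?_, ?_, ?_, ?_⟩ <;> nlinarith [sq_nonneg p]
  all_goals simp [sixF2m, sixN] <;> nlinarith [sq_nonneg p]

/-- The F3 points are relaxed-feasible. -/
theorem Rel_sixF3 (p : ℝ) (hp : 0 ≤ p) : Rel (sixF3 p) := by
  refine ⟨?_, ?_, ?_, ?_, ?_, ?_⟩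
  · unfold K4v
    simp [sixF3, sixN]
    refine ⟨?_, ?_, ?_, ?_, ?_⟩ <;> nlinarith [sq_nonneg p]
  all_goals simp [sixF3, sixN] <;> nlinarith [sq_nonneg p]

/-- Every generator is relaxed-feasible. -/
theorem Rel_base {w : Vec6} (h : Base w) : Rel w := by
  cases h with
  | one => exact Rel_one
  | rayT1 => exact Rel_eT1
  | rayT2 => exact Rel_eT2
  | f1 p hp => exact Rel_sixF1 p hp
  | f2 p hp => exact Rel_sixF2 p hp
  | f2m p hp => exact Rel_sixF2m p hp
  | f3 p hp => exact Rel_sixF3 p hp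

/-! ## (P) at the triangle on every pair of generators, hence on the generated cone -/

/-- **The generator pairs**: (P) at the triangle for every pair of generators — the ten curve pairs of the bridge
module, the apex against anything, the rays against anything. -/
theorem K4v_thetaTri_base {e e' : Vec6} (h : Base e) (h' : Base e') : K4v (thetaTri e e') := by
  cases h' with
  | one => exact K4v_thetaTri_one (Rel_base h).k4
  | rayT1 => exact K4v_thetaTri_eT1_right (Rel_base h)
  | rayT2 => exact K4v_thetaTri_eT2_right (Rel_base h)
  | f1 q hq =>
    cases h with
    | one => rw [thetaTri_comm]; exact K4v_thetaTri_one (Rel_sixF1 q hq).k4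
    | rayT1 => rw [thetaTri_comm]; exact K4v_thetaTri_eT1_right (Rel_sixF1 q hq)
    | rayT2 => rw [thetaTri_comm]; exact K4v_thetaTri_eT2_right (Rel_sixF1 q hq)
    | f1 p hp => exact K4v_thetaTri_F1_F1 p q hp hq
    | f2 p hp => rw [thetaTri_comm]; exact K4v_thetaTri_F1_F2 q p hq hp
    | f2m p hp => rw [thetaTri_comm]; exact K4v_thetaTri_F1_F2m q p hq hp
    | f3 p hp => rw [thetaTri_comm]; exact K4v_thetaTri_F1_F3 q p hq hp
  | f2 q hq =>
    cases h with
    | one => rw [thetaTri_comm]; exact K4v_thetaTri_one (Rel_sixF2 q hq).k4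
    | rayT1 => rw [thetaTri_comm]; exact K4v_thetaTri_eT1_right (Rel_sixF2 q hq)
    | rayT2 => rw [thetaTri_comm]; exact K4v_thetaTri_eT2_right (Rel_sixF2 q hq)
    | f1 p hp => exact K4v_thetaTri_F1_F2 p q hp hq
    | f2 p hp => exact K4v_thetaTri_F2_F2 p q hp hq
    | f2m p hp => rw [thetaTri_comm]; exact K4v_thetaTri_F2_F2m q p hq hp
    | f3 p hp => rw [thetaTri_comm]; exact K4v_thetaTri_F2_F3 q p hq hp
  | f2m q hq =>
    cases h with
    | one => rw [thetaTri_comm]; exact K4v_thetaTri_one (Rel_sixF2m q hq).k4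
    | rayT1 => rw [thetaTri_comm]; exact K4v_thetaTri_eT1_right (Rel_sixF2m q hq)
    | rayT2 => rw [thetaTri_comm]; exact K4v_thetaTri_eT2_right (Rel_sixF2m q hq)
    | f1 p hp => exact K4v_thetaTri_F1_F2m p q hp hq
    | f2 p hp => exact K4v_thetaTri_F2_F2m p q hp hq
    | f2m p hp => exact K4v_thetaTri_F2m_F2m p q hp hq
    | f3 p hp => rw [thetaTri_comm]; exact K4v_thetaTri_F2m_F3 q p hq hp
  | f3 q hq =>
    cases h with
    | one => rw [thetaTri_comm]; exact K4v_thetaTri_one (Rel_sixF3 q hq).k4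
    | rayT1 => rw [thetaTri_comm]; exact K4v_thetaTri_eT1_right (Rel_sixF3 q hq)
    | rayT2 => rw [thetaTri_comm]; exact K4v_thetaTri_eT2_right (Rel_sixF3 q hq)
    | f1 p hp => exact K4v_thetaTri_F1_F3 p q hp hq
    | f2 p hp => exact K4v_thetaTri_F2_F3 p q hp hq
    | f2m p hp => exact K4v_thetaTri_F2m_F3 p q hp hq
    | f3 p hp => exact K4v_thetaTri_F3_F3 p q hp hq

/-- (P) at the triangle for a cone member against a generator (linearity in the first zone). -/
theorem K4v_thetaTri_genCone_base {w e' : Vec6} (hw : GenCone w) (h' : Base e') : K4v (thetaTri w e') := by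
  induction hw with
  | base h => exact K4v_thetaTri_base h h'
  | add _ _ ihx ihy => rw [thetaTri_add_left]; exact K4v_add ihx ihy
  | smul c hc _ ih => rw [thetaTri_smul_left]; exact K4v_smul ih hc

/-- **(P) at the triangle on the generated cone**: for `w, w′ ∈ GenCone`, `K4v (thetaTri w w′)`. -/
theorem K4v_thetaTri_of_genCone {w w' : Vec6} (hw : GenCone w) (hw' : GenCone w') : K4v (thetaTri w w') := by
  induction hw' with
  | base h' => exact K4v_thetaTri_genCone_base hw h'
  | add _ _ ihx ihy => rw [thetaTri_add_right]; exact K4v_add ihx ihy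
  | smul c hc _ ih => rw [thetaTri_smul_right]; exact K4v_smul ih hc

end RelaxedTriangle

end PercRepro
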